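import Summits.BirchSwinnertonDyer.BirchSwinnertonDyer.Theses.PrintX10b
import Literature.NumberTheory.EllipticCurves.PAdicLFunctionMuInvariantCertificateProofs
import Literature.NumberTheory.EllipticCurves.PAdicLFunctionIntegralityAtTwoProofs
import HarnessLib

/-!
# LINE `theoremB-x10b` on crux 20682 `PrintX10b.AnalyticMuZeroX10b`, stub 3b `stub_muAnZero_of_unitMeasure`:
# a unit value of the Mazur–Swinnerton-Dyer measure at `p = 3` gives a unit coefficient of `L_3(f, α)`

Cell `bsd-print-x9`, seat p2 gen 3 (μ-lane), for LINE B v4 (skeleton 41c1930e4741df0b on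
stmt-BirchSwinnertonDyer-20682, cell `bsd-f3-mu`, lead `bsd-f3-mu-p1`; stub 3b assigned to this seat, LINES TABLE
row 4, 20:44Z). HONEST FRAMING: theorems only, no definition, no named fact, no `sorry`; `--supports
stmt-BirchSwinnertonDyer-20682`; nothing is booked; the stub is proved EXACTLY as registered.

* `muAnZeroAt_of_isUnit_of_one_le_norm_msdMeasure_three` — for `E = W` good ordinary at `3` with `E[3]`
  irreducible and `f` a newform of `E`: a unit residue `a mod 3^{m+1}` with `1 ≤ ‖μ_{f,α}(a + 3^{m+1}ℤ₃)‖`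
  gives `∃ n, ‖[Tⁿ] L_3(f, α)‖ = 1`. Mechanism: every unit of `ℤ/3^{m+1}` is `±γˢ` (`γ = 4`;
  `exists_coe_eq_toZModPow_mul_pow`, the Teichmüller representatives of `ℤ₃` being `±1`), the measure is EVEN
  (`msdMeasure_neg`), so the `ω⁰`-orbit sum `ν_m(s) = μ(γˢ) + μ(−γˢ) = 2μ(a)` is a `3`-adic unit, and the
  abstract certificate `exists_lt_norm_limUnder_riemannSum_of_lt_norm_orbitSum` (Newton inversion + the uniform
  Lucas bound, `PAdicLFunctionMuInvariantCertificateProofs`) yields a coefficient of norm `> 3⁻¹`, hence `= 1`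
  by integrality (`norm_msdMeasure_le_one` + `not_irreducible_of_frobeniusTrace_congr_holds`).
* `stub_muAnZero_of_unitMeasure` — the registered signature verbatim (namespace
  `Summit.BirchSwinnertonDyer.BirchSwinnertonDyer.Cruxes.AnalyticMuZeroX10b.TheoremB`).

beyond-print theorem: no (MTT §I.10–I.13 folklore made kernel). References: [MazurTateTeitelbaum1986Invent]
§I.10 (10.1)–(10.2), §I.13; [GreenbergVatsal2000] Prop. 3.7; cell bsd-f3-mu MEMO-an §12.1.
-/

-- the summit and its single problem are both named `BirchSwinnertonDyer` (registry layout D-0017)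
set_option linter.dupNamespace false

noncomputable section

open scoped Classical MatrixGroups ModularForm

open CongruenceSubgroup WeierstrassCurve Literature.NumberTheory.EllipticCurves
  Literature.NumberTheory.EllipticCurves.ModularForms

namespace Summit.BirchSwinnertonDyer.BirchSwinnertonDyer.Cruxes.AnalyticMuZeroX10b.TheoremB

/-- **A unit value of `μ_{f,α}` at `p = 3` forces a unit coefficient of `L_3(f, α)`.** For `E = W` good ordinary
at `3` with `E[3]` irreducible and `f` a newform of `E` (`α = unitRoot W 3`): if `1 ≤ ‖μ_{f,α}(a + 3^{m+1}ℤ₃)‖` for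
some unit residue `a mod 3^{m+1}`, then `‖[Tⁿ] L_3(f,α)‖ = 1` for some `n`. At `3` the Teichmüller orbit of `a`
is `{±a}` and `μ_{f,α}` is even, so the `ω⁰`-orbit sum through `a` is `2·μ_{f,α}(a)`, a `3`-adic unit; then the
abstract `μ = 0` certificate of `PAdicLFunctionMuInvariantCertificateProofs` applies.
[cite: MazurTateTeitelbaum1986Invent, §I.10 (10.1)–(10.2) and §I.13] [cite: GreenbergVatsal2000, Prop. 3.7] -/
theorem muAnZeroAt_of_isUnit_of_one_le_norm_msdMeasure_three (W : WeierstrassCurve ℚ) [W.IsElliptic]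
    [W.IsGloballyMinimal] {N : ℕ} [NeZero N] (f : CuspForm (Gamma0 N) 2) (hord : IsOrdinaryAt W 3)
    (hf : IsNewformOf W f) (hirr : W.HasIrreducibleModPGaloisRep 3) {m : ℕ} {a : ZMod (3 ^ (m + 1))}
    (hau : IsUnit a) (ha1 : 1 ≤ ‖msdMeasure f (unitRoot W 3 : ℚ_[3]) (m + 1) a‖) :
    ∃ n : ℕ, ‖PowerSeries.coeff n (padicLFunction f (unitRoot W 3 : ℚ_[3]))‖ = 1 := by
  have h32 : (3 : ℕ) ≠ 2 := by decide
  -- standing data: distribution relation, integrality, `|α|₃ = 1`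
  have hdist := msdMeasure_distribution_of_isNewformOf hord hf
  obtain ⟨n₀, hpn₀, h0⟩ :=
    exists_intCast_mul_modularSymbol_zero_mem not_irreducible_of_frobeniusTrace_congr_holds hf hirr
  have hpN : ¬ 3 ∣ N := not_dvd_level_of_isNewformOf hf hord.1
  have hαu : ‖(unitRoot W 3 : ℚ_[3])‖ = 1 := (unitRoot_coe_spec (W := W) hord).2.1
  have hint : ∀ (n : ℕ) (b : ZMod (3 ^ n)), ‖msdMeasure f (unitRoot W 3 : ℚ_[3]) n b‖ ≤ 1 :=
    norm_msdMeasure_le_one h32 hpN hpn₀ h0 hαu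
  -- `a = η̄₀ γˢ` with `η₀ ∈ μ₂(ℤ₃) = {±1}`
  obtain ⟨ξ₀, s, hξs⟩ := exists_coe_eq_toZModPow_mul_pow h32 m hau.unit
  rw [hau.unit_spec] at hξs
  -- constants at `p = 3`
  have he : cyclotomicExponent 3 = 1 := by unfold cyclotomicExponent; exact if_neg h32
  have hτ : torsionOrder 3 = 2 := by rw [torsionOrder_eq, if_neg h32]
  haveI := neZero_torsionOrder 3
  haveI := Fintype.ofFinite (rootsOfUnity (torsionOrder 3) ℤ_[3])
  -- every Teichmüller representative of `ℤ₃` is `±1`, so every term of the orbit sum equals `μ(γˢ)`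
  have hroot : ∀ ξ : rootsOfUnity (torsionOrder 3) ℤ_[3],
      ((ξ : ℤ_[3]ˣ) : ℤ_[3]) = 1 ∨ ((ξ : ℤ_[3]ˣ) : ℤ_[3]) = -1 := by
    intro ξ
    have h := rootsOfUnity_pow_torsionOrder 3 ξ
    have h2 : ((ξ : ℤ_[3]ˣ) : ℤ_[3]) * ((ξ : ℤ_[3]ˣ) : ℤ_[3]) = 1 := by
      rw [← pow_two, ← hτ]
      exact h
    exact mul_self_eq_one_iff.mp h2
  have hterm : ∀ ξ : rootsOfUnity (torsionOrder 3) ℤ_[3],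
      msdMeasure f (unitRoot W 3 : ℚ_[3]) (m + 1)
        (PadicInt.toZModPow (m + 1) ((ξ : ℤ_[3]ˣ) : ℤ_[3]) *
          (cyclotomicGenerator 3 : ZMod (3 ^ (m + 1))) ^ s.val) =
      msdMeasure f (unitRoot W 3 : ℚ_[3]) (m + 1)
        ((cyclotomicGenerator 3 : ZMod (3 ^ (m + 1))) ^ s.val) := by
    intro ξ
    rcases hroot ξ with h | h
    · rw [h, map_one, one_mul]
    · rw [h, map_neg, map_one, neg_one_mul, msdMeasure_neg]
  -- in particular `μ(a) = μ(γˢ)`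
  have ha : msdMeasure f (unitRoot W 3 : ℚ_[3]) (m + 1) a =
      msdMeasure f (unitRoot W 3 : ℚ_[3]) (m + 1)
        ((cyclotomicGenerator 3 : ZMod (3 ^ (m + 1))) ^ s.val) := by
    rw [hξs, hterm ξ₀]
  -- the orbit sum `ν_m(s) = 2·μ(γˢ)` is a unit
  have h2 : ‖((2 : ℤ) : ℚ_[3])‖ = 1 :=
    le_antisymm (Padic.norm_int_le_one _)
      (not_lt.mp fun hlt ↦ absurd (Padic.norm_intCast_lt_one_iff.mp hlt) (by decide))
  have hs₀ : (1 : ℝ) * ((3 : ℕ) : ℝ)⁻¹ < ‖∑ᶠ ξ : rootsOfUnity (torsionOrder 3) ℤ_[3],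
      msdMeasure f (unitRoot W 3 : ℚ_[3]) (m + cyclotomicExponent 3)
        (PadicInt.toZModPow (m + cyclotomicExponent 3) ((ξ : ℤ_[3]ˣ) : ℤ_[3]) *
          (cyclotomicGenerator 3 : ZMod (3 ^ (m + cyclotomicExponent 3))) ^ s.val)‖ := by
    rw [he, finsum_eq_sum_of_fintype, Finset.sum_congr rfl fun ξ _ ↦ hterm ξ, Finset.sum_const,
      Finset.card_univ, ← Nat.card_eq_fintype_card, card_rootsOfUnity_torsionOrder, hτ, ← ha,
      nsmul_eq_mul, norm_mul, show ((2 : ℕ) : ℚ_[3]) = ((2 : ℤ) : ℚ_[3]) by norm_cast, h2, one_mul,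
      one_mul]
    calc ((3 : ℕ) : ℝ)⁻¹ < 1 := by norm_num
      _ ≤ _ := ha1
  obtain ⟨k, -, hk⟩ := exists_lt_norm_limUnder_riemannSum_of_lt_norm_orbitSum
    (μ := msdMeasure f (unitRoot W 3 : ℚ_[3])) (RS := padicLRiemannSum f (unitRoot W 3 : ℚ_[3]))
    (fun _ _ ↦ rfl) hdist hint hs₀
  rw [one_mul] at hk
  exact ⟨k, by
    rw [coeff_padicLFunction]
    exact norm_eq_one_of_inv_lt_of_le_one hk (norm_padicLCoeff_le_one hdist hint k)⟩

/-- **Stub 3b of LINE `theoremB-x10b` (v4, skeleton 41c1930e4741df0b), EXACTLY as registered**: for `E = W` good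
ordinary at `3`, `f` a newform of `E`, `E[3]` irreducible, a unit residue `a mod 3^{m+1}` with
`1 ≤ ‖μ_{f,α}(a + 3^{m+1}ℤ₃)‖` gives a `3`-adic unit coefficient of `L_3(f, α_E)`.
[cite: MazurTateTeitelbaum1986Invent, §I.10 (10.1)–(10.2) and §I.13] [cite: GreenbergVatsal2000, Prop. 3.7] -/
theorem stub_muAnZero_of_unitMeasure :
    ∀ (W : WeierstrassCurve ℚ) [W.IsElliptic] [W.IsGloballyMinimal] {N : ℕ} [NeZero N]
      (f : CuspForm (Gamma0 N) 2), IsOrdinaryAt W 3 → IsNewformOf W f → W.HasIrreducibleModPGaloisRep 3 →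
      (∃ (m : ℕ) (a : ZMod (3 ^ (m + 1))), IsUnit a ∧ 1 ≤ ‖msdMeasure f (unitRoot W 3 : ℚ_[3]) (m + 1) a‖) →
      ∃ n : ℕ, ‖PowerSeries.coeff n (padicLFunction f (unitRoot W 3 : ℚ_[3]))‖ = 1 := by
  intro W _ _ N _ f hord hf hirr h
  obtain ⟨m, a, hau, ha1⟩ := h
  exact muAnZeroAt_of_isUnit_of_one_le_norm_msdMeasure_three W f hord hf hirr hau ha1

end Summit.BirchSwinnertonDyer.BirchSwinnertonDyer.Cruxes.AnalyticMuZeroX10b.TheoremB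

end
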